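import Summits.ABC.IUTFork.Conditional.WRowFrey301327048Packages
import HarnessLib

/-!
# R-W WINDOW-TABLE, W1 ROW DECISION (inhabited side): the known abc triple `1 + 3¹⁶·7 = 2³·11·23·53³` at `l = 23`
# — the hull licence S_H HOLDS at every genuine Θ-volume datum over `(ratPoint (1/301327048), 23)` of the TABULATED LOCAL TYPE

PROOF-ONLY file (D-0012; 0 definitions, 0 `Prop` facts) of the abc-iut cell — D-0079 RESCUE sub-cell R-W «WINDOW Θ-SIDE INEQUALITY», W1 ROW
DECISIONS composer seat abc-iut-W-row-1 (gen 0); row 4 of HOME/plan/rescue/R-W/OPEN-10.md (sha16 1b0025ee7a8ba6d7, abc-iut-rw-num-lead):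
`pilotDataOfK:frey-1-301327047-301327048:23`. Over `WRowFrey301327048Packages` / `WRowFrey283Packages` (local packages, pole orders, bad
primes) and the sockets `Cor312LicenceWildInhabitedRealising` / `…GenuineK` (abc-iut-w4-d036's U2-LICENCE-WRAPPER composed over all tuples).
TAKES NO SIDE on [IUTchIII] Cor. 3.12 (S. Mochizuki, *Inter-universal Teichmüller theory III*, Cor. 3.12 p. 173–174; Step (xi-f) p. 184) or on
any author; «inhabited as typed» ≠ «asserted in print».

WHAT IS PROVED (namespace `Summit.ABC.IUTFork.Conditional`): **`WRow.licence_frey301327048_twentyThree`** — for EVERY genuine Θ-volume datum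
`T` at `(ratPoint (1/301327048), 23)` and EVERY pair of realising Θ- and q-ideles: IF the bad completions have the LOCAL TYPE of the table — over
`3` (wild): `e = 690`, different exponent `≥ 1379`, AND the lower tie reading of the inner radius (`ϖ^{344}·𝒪 ⊄ log_p(𝒪^×)`, i.e. `r_in ≥ A = 345`;
at this index `3 ∣ A`, the one inner-radius case abc-iut-c312-3 left open, so it is an INPUT here — the trivial reading `ρin = 1` misses this
row by 1368 at the top label); over `7`: a common `e ∈ {345, 690}`; over `11`: `e = 690`; over `53`: `e = 230` — and are pairwise
`ℚ_p`-isomorphic over each bad prime, THEN abc-iut-c312-1's `Thm311ToCor312.Licence` HOLDS at `settingPrVolSharp (pilotDataOfK T.D T.K) …`.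
Integer cells at every label `j ≤ 11` by `decide` (margins ≥ 2772 (p=3), 2089/4864 (7), 3928 (11), 614 (53)).
READING (neutral; numbers, not adjectives): the per-datum S_H clause of the window certificates' binder `hSHwBad` (p453137 / p450130) is INHABITED
at this Szpiro-BAD admissible-candidate row CONDITIONALLY on the local type at the bad primes (GAP-LEDGER G-Wnum2-1 at `3`, including the
inner-radius lower reading there; the pinned tame types of abc-iut-W-num-3) and the conjugacy of the bad fibre. Admissibility / (P6) of
`(ratPoint λ, 23)` and NON-EMPTINESS of the datum type are NOT claimed. HONEST SCOPE: OUR sharp containers; STRONGER-THAN-PRINT hull reading;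
nothing about the printed inequality or any author's intended hull; typed ≠ proved; instantiated ≠ endorsed; no abc claim.
[cite: Mochizuki2012, IUTchI Def. 3.1 (b),(c) pp. 61–62, Ex. 3.2 (iv) p. 71; IUTchIII Cor. 3.12 Step (xi-f) p. 184; IUTchIV Prop. 1.1 p. 9,
Prop. 1.2 (i)(ii) p. 10, Cor. 2.2 (ii) proof (P5) p. 46] [cite: DupuyHilado2025, §3.3, §3.4, §4.9, §4.12] [cite: NeukirchANT1999, Ch. II (5.5)]
[claim: Mochizuki2012, status: disputed] for every IUT sentence.
-/

noncomputable section

open Set Function Metric NumberField IsDedekindDomain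

namespace Summit.ABC.IUTFork.Conditional

open Thm311 Thm311.Real Cor312 Cor312Vol Cor312Prov Literature.IUT.LogThetaLattice Literature.IUT.LogVolume
  Literature.IUT.HodgeTheaters Literature.IUT.LogVolume.Cor22
open Literature.NumberTheory.NumberFields Literature.NumberTheory.GaloisRepresentations.Ultrametric
open Literature.NumberTheory.DiophantineGeometry Literature.NumberTheory.DiophantineGeometry.GenEll

/-- **W1 ROW DECISION, INHABITED SIDE — `1 + 3¹⁶·7 = 2³·11·23·53³` at `l = 23`.** For EVERY genuine Θ-volume datum `T` at
`(ratPoint (1/301327048), 23)` and EVERY pair of Θ- and q-ideles realising the pilot divisors of `X := pilotDataOfK T.D T.K`: IF the completions at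
the bad places have the TABULATED LOCAL TYPE — over `3`: `e = 690`, different exponent `≥ 1379` and a non-member of `log_3(𝒪^×)` of norm
`≤ 3^{−344/690}` (lower tie reading `r_in ≥ 345`); over `7`: a common `e ∈ {345, 690}`; over `11`: `e = 690`; over `53`: `e = 230` — and are pairwise
`ℚ_p`-isomorphic over each bad prime, THEN abc-iut-c312-1's `Thm311ToCor312.Licence` HOLDS at abc-iut-c312-7's `settingPrVolSharp X …`.
[cite: Mochizuki2012, IUTchIII Cor. 3.12 Step (xi-f) p. 184; IUTchIV Prop. 1.1 p. 9, Prop. 1.2 (i)(ii) p. 10, Cor. 2.2 (ii) p. 46]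
[cite: DupuyHilado2025, §3.3, §3.4, §4.9, §4.12] [claim: Mochizuki2012, status: disputed] -/
theorem WRow.licence_frey301327048_twentyThree (T : Cor22.ThetaVolumeDatumAt (ratPoint ((1 : ℚ) / 301327048)) 23) (e7 : ℕ)
    (he7 : e7 = 345 ∨ e7 = 690) :
    letI := T.instFieldF; letI := T.instNumberFieldF; letI := T.instAlgebraF; letI := T.instFieldK
    letI := T.instNumberFieldK; letI := T.instAlgebraK; letI := T.instFieldFbar; letI := T.instAlgebraFbar
    letI := T.instAlgebraKFbar; letI := T.instIsElliptic
    -- LOCAL TYPE at the bad primes (hypotheses) and conjugacy of the bad fibre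
    (∀ (pp : Nat.Primes), (pp : ℕ) = 3 → ∀ x : (thetaIndex (pilotDataOfK T.D T.K)).Fibre (.inr pp),
        haveI : Fact (pp : ℕ).Prime := ⟨pp.2⟩
        placeOf (pilotDataOfK T.D T.K) pp.1 x ∈ (pilotDataOfK T.D T.K).S →
          absRamificationIdx (pp : ℕ) (kOf (pilotDataOfK T.D T.K) pp.1 x) = 690 ∧
            ((1379 : ℕ) : ℝ) / ((690 : ℕ) : ℝ) ≤ differentOrd (pp : ℕ) (kOf (pilotDataOfK T.D T.K) pp.1 x) ∧
            ∃ z : kOf (pilotDataOfK T.D T.K) pp.1 x, z ∉ logUnits (kOf (pilotDataOfK T.D T.K) pp.1 x) ∧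
              ‖z‖ ≤ ((pp : ℕ) : ℝ) ^ (-((((345 : ℤ) : ℝ) - 1) / ((690 : ℕ) : ℝ)))) →
    (∀ (pp : Nat.Primes), (pp : ℕ) = 7 → ∀ x : (thetaIndex (pilotDataOfK T.D T.K)).Fibre (.inr pp),
        haveI : Fact (pp : ℕ).Prime := ⟨pp.2⟩
        placeOf (pilotDataOfK T.D T.K) pp.1 x ∈ (pilotDataOfK T.D T.K).S →
          absRamificationIdx (pp : ℕ) (kOf (pilotDataOfK T.D T.K) pp.1 x) = e7) →
    (∀ (pp : Nat.Primes), (pp : ℕ) = 11 → ∀ x : (thetaIndex (pilotDataOfK T.D T.K)).Fibre (.inr pp),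
        haveI : Fact (pp : ℕ).Prime := ⟨pp.2⟩
        placeOf (pilotDataOfK T.D T.K) pp.1 x ∈ (pilotDataOfK T.D T.K).S →
          absRamificationIdx (pp : ℕ) (kOf (pilotDataOfK T.D T.K) pp.1 x) = 690) →
    (∀ (pp : Nat.Primes), (pp : ℕ) = 53 → ∀ x : (thetaIndex (pilotDataOfK T.D T.K)).Fibre (.inr pp),
        haveI : Fact (pp : ℕ).Prime := ⟨pp.2⟩
        placeOf (pilotDataOfK T.D T.K) pp.1 x ∈ (pilotDataOfK T.D T.K).S →
          absRamificationIdx (pp : ℕ) (kOf (pilotDataOfK T.D T.K) pp.1 x) = 230) →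
    (∀ (pp : Nat.Primes) (x y : (thetaIndex (pilotDataOfK T.D T.K)).Fibre (.inr pp)),
      haveI : Fact (pp : ℕ).Prime := ⟨pp.2⟩
      placeOf (pilotDataOfK T.D T.K) pp.1 x ∈ (pilotDataOfK T.D T.K).S → placeOf (pilotDataOfK T.D T.K) pp.1 y ∈ (pilotDataOfK T.D T.K).S →
        Nonempty (kOf (pilotDataOfK T.D T.K) pp.1 x ≃ₐ[ℚ_[pp]] kOf (pilotDataOfK T.D T.K) pp.1 y)) →
    ∀ {logv : PadicLogs T.K} (hlog : LogvAnalytic logv) (M : Type) [Field M] [NumberField M]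
      (archPk : ∀ (j : (thetaIndex (pilotDataOfK T.D T.K)).Label) (vQ : (thetaIndex (pilotDataOfK T.D T.K)).VQ),
        Set ((logShellsDH (pilotDataOfK T.D T.K) logv).Packet j vQ))
      (archSub : ∀ (j : (thetaIndex (pilotDataOfK T.D T.K)).Label) (v : (thetaIndex (pilotDataOfK T.D T.K)).V),
        Set ((logShellsDH (pilotDataOfK T.D T.K) logv).Packet j ((thetaIndex (pilotDataOfK T.D T.K)).over v)))
      (Ψ : ℤ → ∀ v : (thetaIndex (pilotDataOfK T.D T.K)).V, v ∈ (thetaIndex (pilotDataOfK T.D T.K)).Vbad →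
        Set ((logShellsDH (pilotDataOfK T.D T.K) logv).StarPacket v))
      (act : ℤ → ∀ v : (thetaIndex (pilotDataOfK T.D T.K)).V, v ∈ (thetaIndex (pilotDataOfK T.D T.K)).Vbad →
        (logShellsDH (pilotDataOfK T.D T.K) logv).StarPacket v → Module.End ℚ ((logShellsDH (pilotDataOfK T.D T.K) logv).StarPacket v))
      (Mmod : ℤ → ∀ j : (thetaIndex (pilotDataOfK T.D T.K)).LabelStar, Set ((logShellsDH (pilotDataOfK T.D T.K) logv).GlobalPacket j.1))
      (region : ℤ → ∀ j : (thetaIndex (pilotDataOfK T.D T.K)).LabelStar, FinDivisor M → ∀ vQ : (thetaIndex (pilotDataOfK T.D T.K)).VQ,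
        Set ((logShellsDH (pilotDataOfK T.D T.K) logv).Packet j.1 vQ))
      (n : ℤ) {HT : Type} {LogLink : HT → HT → Type} {IsFull : ∀ {s t : HT}, LogLink s t → Prop}
      (lat : LGPGaussianLogThetaLattice LogLink IsFull)
      {Frd : Type} {IsoF : Frd → Frd → Type} {Ob : Frd → Type} {realify : Frd → Frd} {Strip : Type}
      {IsoS : Strip → Strip → Type} {Mv : ∀ v : (thetaIndex (pilotDataOfK T.D T.K)).V, v ∈ (thetaIndex (pilotDataOfK T.D T.K)).Vbad → Type}
      [∀ v h, Monoid (Mv v h)]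
      (sig : GlobalLGPFrobenioidSignature (thetaIndex (pilotDataOfK T.D T.K)).lstar (thetaIndex (pilotDataOfK T.D T.K)).V
        (· ∈ (thetaIndex (pilotDataOfK T.D T.K)).Vbad) Frd IsoF Ob realify Strip IsoS Mv)
      (split : SplittingMonoids Mv) {ObΔ : Type} {N : ∀ v : (thetaIndex (pilotDataOfK T.D T.K)).V, v ∈ (thetaIndex (pilotDataOfK T.D T.K)).Vbad → Type}
      [∀ v h, Monoid (N v h)] (qData : QPilotData ObΔ N)
      (tq : ∀ (pp : Nat.Primes) (x : (thetaIndex (pilotDataOfK T.D T.K)).Fibre (.inr pp)),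
        haveI : Fact (pp : ℕ).Prime := ⟨pp.2⟩; kOf (pilotDataOfK T.D T.K) pp.1 x)
      (t : ∀ (pp : Nat.Primes) (_ : Fin (pilotDataOfK T.D T.K).lstar) (x : (thetaIndex (pilotDataOfK T.D T.K)).Fibre (.inr pp)),
        haveI : Fact (pp : ℕ).Prime := ⟨pp.2⟩; kOf (pilotDataOfK T.D T.K) pp.1 x)
      (htq0 : ∀ pp x, tq pp x ≠ 0)
      (htq1 : ∀ (pp : Nat.Primes) (x : (thetaIndex (pilotDataOfK T.D T.K)).Fibre (.inr pp)),
        haveI : Fact (pp : ℕ).Prime := ⟨pp.2⟩; placeOf (pilotDataOfK T.D T.K) pp.1 x ∉ (pilotDataOfK T.D T.K).S → ‖tq pp x‖ = 1)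
      (_ht0 : ∀ pp i x, t pp i x ≠ 0)
      (_ht : ∀ (pp : Nat.Primes) (i : Fin (pilotDataOfK T.D T.K).lstar) (x : (thetaIndex (pilotDataOfK T.D T.K)).Fibre (.inr pp)),
        haveI : Fact (pp : ℕ).Prime := ⟨pp.2⟩
        Real.log ‖t pp i x‖ = -((pilotDataOfK T.D T.K).thetaPilot i (placeOf (pilotDataOfK T.D T.K) pp.1 x)) *
          logNorm T.K (placeOf (pilotDataOfK T.D T.K) pp.1 x) / localDegree T.K (placeOf (pilotDataOfK T.D T.K) pp.1 x))
      (_htq : ∀ (pp : Nat.Primes) (x : (thetaIndex (pilotDataOfK T.D T.K)).Fibre (.inr pp)),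
        haveI : Fact (pp : ℕ).Prime := ⟨pp.2⟩
        Real.log ‖tq pp x‖ = -((pilotDataOfK T.D T.K).qPilot (placeOf (pilotDataOfK T.D T.K) pp.1 x)) *
          logNorm T.K (placeOf (pilotDataOfK T.D T.K) pp.1 x) / localDegree T.K (placeOf (pilotDataOfK T.D T.K) pp.1 x)),
      Thm311ToCor312.Licence
        (settingPrVolSharp (pilotDataOfK T.D T.K) hlog M archPk archSub Ψ act Mmod region n lat sig split qData tq t htq0 htq1) := by
  letI := T.instFieldF; letI := T.instNumberFieldF; letI := T.instAlgebraF; letI := T.instFieldK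
  letI := T.instNumberFieldK; letI := T.instAlgebraK; letI := T.instFieldFbar; letI := T.instAlgebraFbar
  letI := T.instAlgebraKFbar; letI := T.instIsElliptic
  intro hloc3 hloc7 hloc11 hloc53 hiso logv hlog M _ _ archPk archSub Ψ act Mmod region n HT LogLink IsFull lat Frd IsoF Ob realify Strip
    IsoS Mv _ sig split ObΔ N _ qData tq t htq0 htq1 ht0 ht htq
  have hjF : T.E.j = ((jInv ((1 : ℚ) / 301327048) : ℚ) : T.F) := by rw [T.j_eq]; exact eq_ratCast _ _
  have hlstar : (pilotDataOfK T.D T.K).lstar = 11 := by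
    show ((pilotDataOfK T.D T.K).l - 1) / 2 = 11
    rw [pilotDataOfK_l]
  -- the per-prime data (e, D, h, ρin, ρout)
  set eF : Nat.Primes → ℕ := fun pp => if (pp : ℕ) = 3 then 690 else if (pp : ℕ) = 11 then 690 else if (pp : ℕ) = 53 then 230 else e7 with heF
  set DF : Nat.Primes → ℕ := fun pp => if (pp : ℕ) = 3 then 1379 else if (pp : ℕ) = 11 then 689 else if (pp : ℕ) = 53 then 229 else e7 - 1 with hDF
  set hF : Nat.Primes → ℕ := fun pp => if (pp : ℕ) = 2 then 6 else if (pp : ℕ) = 3 then 32 else if (pp : ℕ) = 7 then 2 else if (pp : ℕ) = 11 then 2 else if (pp : ℕ) = 23 then 2 else 6 with hhF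
  set rinF : Nat.Primes → ℤ := fun pp => if (pp : ℕ) = 3 then 345 else if (pp : ℕ) = 11 then 69 else if (pp : ℕ) = 53 then 5 else if e7 = 345 then 58 else 115 with hrinF
  set routF : Nat.Primes → ℤ := fun pp => if (pp : ℕ) = 3 then (-3411) else if (pp : ℕ) = 11 then (-1259) else if (pp : ℕ) = 53 then (-177) else if e7 = 345 then (-692) else (-1727) with hroutF
  refine Cor312Prov.licence_settingPrVolSharp_pilotDataOfK_of_orders_rat T.D hlog M archPk archSub Ψ act Mmod region n lat sig split qData
    tq t htq0 htq1 ht0 ht htq (jInv ((1 : ℚ) / 301327048)) hjF eF DF hF rinF routF (fun pp x hx => ?_) hiso (fun pp hpp i => ?_)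
  · -- the local packages at a bad place `x | p`
    haveI : Fact (pp : ℕ).Prime := ⟨pp.2⟩
    rcases (WRow.bad_prime_frey301327048 T pp x hx).2 with ⟨hp, hord⟩ | ⟨hp, hord⟩ | ⟨hp, hord⟩ | ⟨hp, -⟩ | ⟨hp, hord⟩
    · have h1 : eF pp = 690 := by simp [heF, hp]
      have h2 : DF pp = 1379 := by simp [hDF, hp]
      have h3 : hF pp = 32 := by simp [hhF, hp]
      have h4 : rinF pp = 345 := by simp [hrinF, hp]
      have h5 : routF pp = (-3411) := by simp [hroutF, hp]
      rw [h1, h2, h3, h4, h5]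
      obtain ⟨he, hD, hin⟩ := hloc3 pp hp x hx
      exact ⟨he, hD, hin,
        WRow.outer_witness_envelope (pp : ℕ) _ he 6 (by rw [hp]; decide) (by rw [hp]; decide) (-3411) (by rw [hp]; norm_num),
        by simpa using hord, by decide⟩
    · have he := hloc7 pp hp x hx
      rcases he7 with rfl | rfl
      · have h1 : eF pp = 345 := by simp [heF, hp]
        have h2 : DF pp = 344 := by simp [hDF, hp]
        have h3 : hF pp = 2 := by simp [hhF, hp]
        have h4 : rinF pp = 58 := by simp [hrinF, hp]
        have h5 : routF pp = (-692) := by simp [hroutF, hp]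
        rw [h1, h2, h3, h4, h5]
        exact ⟨he, WRow.different_lower_of_not_dvd (pp : ℕ) _ he (by rw [hp]; norm_num) 344 (by norm_num),
          WRow.inner_witness_of_not_dvd (pp : ℕ) _ he (by rw [hp]; norm_num) 58 (by rw [hp]; norm_num),
          WRow.outer_witness_envelope (pp : ℕ) _ he 3 (by rw [hp]; decide) (by rw [hp]; decide) (-692) (by rw [hp]; norm_num),
          by simpa using hord, by decide⟩
      · have h1 : eF pp = 690 := by simp [heF, hp]
        have h2 : DF pp = 689 := by simp [hDF, hp]
        have h3 : hF pp = 2 := by simp [hhF, hp]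
        have h4 : rinF pp = 115 := by simp [hrinF, hp]
        have h5 : routF pp = (-1727) := by simp [hroutF, hp]
        rw [h1, h2, h3, h4, h5]
        exact ⟨he, WRow.different_lower_of_not_dvd (pp : ℕ) _ he (by rw [hp]; norm_num) 689 (by norm_num),
          WRow.inner_witness_tie_of_not_dvd (pp : ℕ) _ he 115 (by rw [hp]) (by rw [hp]; norm_num),
          WRow.outer_witness_envelope (pp : ℕ) _ he 3 (by rw [hp]; decide) (by rw [hp]; decide) (-1727) (by rw [hp]; norm_num),
          by simpa using hord, by decide⟩
    · have h1 : eF pp = 690 := by simp [heF, hp]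
      have h2 : DF pp = 689 := by simp [hDF, hp]
      have h3 : hF pp = 2 := by simp [hhF, hp]
      have h4 : rinF pp = 69 := by simp [hrinF, hp]
      have h5 : routF pp = (-1259) := by simp [hroutF, hp]
      rw [h1, h2, h3, h4, h5]
      have he := hloc11 pp hp x hx
      exact ⟨he, WRow.different_lower_of_not_dvd (pp : ℕ) _ he (by rw [hp]; norm_num) 689 (by norm_num),
        WRow.inner_witness_tie_of_not_dvd (pp : ℕ) _ he 69 (by rw [hp]) (by rw [hp]; norm_num),
        WRow.outer_witness_envelope (pp : ℕ) _ he 2 (by rw [hp]; decide) (by rw [hp]; decide) (-1259) (by rw [hp]; norm_num),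
        by simpa using hord, by decide⟩
    · exact absurd hp (WRow.bad_prime_frey301327048 T pp x hx).1
    · have h1 : eF pp = 230 := by simp [heF, hp]
      have h2 : DF pp = 229 := by simp [hDF, hp]
      have h3 : hF pp = 6 := by simp [hhF, hp]
      have h4 : rinF pp = 5 := by simp [hrinF, hp]
      have h5 : routF pp = (-177) := by simp [hroutF, hp]
      rw [h1, h2, h3, h4, h5]
      have he := hloc53 pp hp x hx
      exact ⟨he, WRow.different_lower_of_not_dvd (pp : ℕ) _ he (by rw [hp]; norm_num) 229 (by norm_num),
        WRow.inner_witness_of_not_dvd (pp : ℕ) _ he (by rw [hp]; norm_num) 5 (by rw [hp]; norm_num),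
        WRow.outer_witness_envelope (pp : ℕ) _ he 1 (by rw [hp]; decide) (by rw [hp]; decide) (-177) (by rw [hp]; norm_num),
        by simpa using hord, by decide⟩
  · -- the integer cells at every label `j = i + 1 ≤ 11`
    haveI : Fact (pp : ℕ).Prime := ⟨pp.2⟩
    obtain ⟨x, hx⟩ := hpp
    have hi : (i : ℕ) < 11 := hlstar ▸ i.isLt
    generalize hk : (i : ℕ) = k at hi ⊢
    rcases (WRow.bad_prime_frey301327048 T pp x hx).2 with ⟨hp, -⟩ | ⟨hp, -⟩ | ⟨hp, -⟩ | ⟨hp, -⟩ | ⟨hp, -⟩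
    · have h1 : eF pp = 690 := by simp [heF, hp]
      have h2 : DF pp = 1379 := by simp [hDF, hp]
      have h3 : hF pp = 32 := by simp [hhF, hp]
      have h4 : rinF pp = 345 := by simp [hrinF, hp]
      have h5 : routF pp = (-3411) := by simp [hroutF, hp]
      rw [h1, h2, h3, h4, h5]
      interval_cases k <;> decide
    · rcases he7 with rfl | rfl
      · have h1 : eF pp = 345 := by simp [heF, hp]
        have h2 : DF pp = 344 := by simp [hDF, hp]
        have h3 : hF pp = 2 := by simp [hhF, hp]
        have h4 : rinF pp = 58 := by simp [hrinF, hp]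
        have h5 : routF pp = (-692) := by simp [hroutF, hp]
        rw [h1, h2, h3, h4, h5]
        interval_cases k <;> decide
      · have h1 : eF pp = 690 := by simp [heF, hp]
        have h2 : DF pp = 689 := by simp [hDF, hp]
        have h3 : hF pp = 2 := by simp [hhF, hp]
        have h4 : rinF pp = 115 := by simp [hrinF, hp]
        have h5 : routF pp = (-1727) := by simp [hroutF, hp]
        rw [h1, h2, h3, h4, h5]
        interval_cases k <;> decide
    · have h1 : eF pp = 690 := by simp [heF, hp]
      have h2 : DF pp = 689 := by simp [hDF, hp]
      have h3 : hF pp = 2 := by simp [hhF, hp]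
      have h4 : rinF pp = 69 := by simp [hrinF, hp]
      have h5 : routF pp = (-1259) := by simp [hroutF, hp]
      rw [h1, h2, h3, h4, h5]
      interval_cases k <;> decide
    · exact absurd hp (WRow.bad_prime_frey301327048 T pp x hx).1
    · have h1 : eF pp = 230 := by simp [heF, hp]
      have h2 : DF pp = 229 := by simp [hDF, hp]
      have h3 : hF pp = 6 := by simp [hhF, hp]
      have h4 : rinF pp = 5 := by simp [hrinF, hp]
      have h5 : routF pp = (-177) := by simp [hroutF, hp]
      rw [h1, h2, h3, h4, h5]
      interval_cases k <;> decide

end Summit.ABC.IUTFork.Conditional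

end
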